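import Mathlib.NumberTheory.ModularForms.SlashActions
import Mathlib.Analysis.SpecialFunctions.Complex.Log
import HarnessLib

/-!
# Pinning theta multipliers through an Eisenstein series: the abstract argument (toward K0⁺, stmt-20690)

Route `ResidualThetaTransportAtTwo`, crux K0⁺ `HeckeThetaPartnerAdicAtTwo` (stmt-BirchSwinnertonDyer-20690),
line "Hecke theta series from the genus-two Riemann theta function".  THEOREMS ONLY, no number
theory: the analytic lemma that converts

* a finite family of `q`-series `θ_i(τ) = 1 + Σ_{n≥1} r_i(n) qⁿ` on `ℍ` with weight-one laws
  `θ_i(γτ) = Λ_i (cτ+d) θ_i(τ)` (`|Λ_i| = 1`) and `θ_i(γ₀τ) = Λ⁰_i (Dτ+1) θ_i(τ)` for `γ₀ = (1 0; D 1)`,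
* a `q`-series `E(τ) = Σ e(n) qⁿ` with `e(0) ≠ 0`, `E(γτ) = χ (cτ+d) E(τ)`, `E(γ₀τ) = (Dτ+1) E(τ)`,
* and the coefficient identity `w e(n) = c₁ Σ_i r_i(n)` (`n ≥ 1`),

into `Λ_i = χ` for every `i` (`units_eq_of_thetaSum_eisenstein`).  Mechanism: `wE - c₁Σθ_i` is the
constant `K₀ = w e(0) - c₁ h`; transporting by `γ₀` and using `1`-periodicity gives `K₀ = 0`; then
transporting `wE = c₁Σθ_i` by `γ` and letting `Im τ → ∞` gives `Σ_i Λ_i = h χ`, and unit complex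
numbers summing to `h χ` are all equal to `χ` (`eq_of_sum_eq_card_mul`).  Used with
`θ_i` = theta nulls of ideal-class representatives and `E` = Hecke's weight-one Eisenstein series.

BSD is not proved by this file.
-/

set_option autoImplicit false
set_option linter.dupNamespace false

noncomputable section

open scoped Real MatrixGroups Topology UpperHalfPlane
open Complex Filter ModularForm

namespace Summit.BirchSwinnertonDyer.BirchSwinnertonDyer.Theorems.HeckeTheta

/-! ### Unit complex numbers summing to `h · χ` -/

/-- If `h` complex numbers of modulus `1` sum to `h · χ` with `|χ| = 1`, they all equal `χ`. -/
theorem eq_of_sum_eq_card_mul {ι : Type} [Fintype ι] {Λ : ι → ℂ} {χ : ℂ}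
    (hΛ : ∀ i, ‖Λ i‖ = 1) (hχ : ‖χ‖ = 1) (hsum : ∑ i, Λ i = Fintype.card ι * χ) (i : ι) :
    Λ i = χ := by
  have hχ0 : χ ≠ 0 := fun h => by rw [h, norm_zero] at hχ; exact zero_ne_one hχ
  -- `μ_i = Λ_i χ̄ / |χ|² = Λ_i / χ` has modulus one and real part `≤ 1`, and `Σ μ_i = h`
  set μ : ι → ℂ := fun j => Λ j / χ with hμ
  have hμ1 : ∀ j, ‖μ j‖ = 1 := fun j => by rw [hμ]; simp [hΛ j, hχ]
  have hμsum : ∑ j, μ j = Fintype.card ι := by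
    simp only [hμ, div_eq_mul_inv, ← Finset.sum_mul, hsum]
    field_simp
  have hre_le : ∀ j, (μ j).re ≤ 1 := fun j => (Complex.re_le_norm _).trans (hμ1 j).le
  have hre_sum : ∑ j, (μ j).re = Fintype.card ι := by
    have := congrArg Complex.re hμsum
    rw [Complex.re_sum] at this
    simpa using this
  -- all real parts equal `1`
  have hre1 : ∀ j, (μ j).re = 1 := by
    by_contra hcon
    push Not at hcon
    obtain ⟨j₀, hj₀⟩ := hcon
    have hlt : (μ j₀).re < 1 := lt_of_le_of_ne (hre_le j₀) hj₀
    have : ∑ j, (μ j).re < ∑ _j : ι, (1 : ℝ) :=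
      Finset.sum_lt_sum (fun j _ => hre_le j) ⟨j₀, Finset.mem_univ _, hlt⟩
    rw [hre_sum] at this
    simp at this
  have hμeq : μ i = 1 := by
    have h1 := hμ1 i
    have h2 := hre1 i
    have him : (μ i).im = 0 := by
      have : (μ i).re * (μ i).re + (μ i).im * (μ i).im = 1 := by
        rw [← Complex.normSq_apply, Complex.normSq_eq_norm_sq, h1, one_pow]
      rw [h2] at this
      nlinarith
    exact Complex.ext (by simp [h2]) (by simp [him])
  have : Λ i / χ = 1 := hμeq
  rwa [div_eq_one_iff_eq hχ0] at this

/-! ### The abstract Eisenstein pinning -/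

/-- `e(τ + 1) = e(τ)`: `q` is `1`-periodic. -/
private theorem cexp_two_pi_I_vadd (τ : ℍ) :
    cexp (2 * π * Complex.I * (((1 : ℝ) +ᵥ τ : ℍ) : ℂ)) = cexp (2 * π * Complex.I * (τ : ℂ)) := by
  rw [UpperHalfPlane.coe_vadd, Complex.ofReal_one, mul_add, mul_one, Complex.exp_add,
    Complex.exp_two_pi_mul_I, one_mul]

/-- **Eisenstein pinning of theta multipliers.**  See the module docstring.  Hypotheses: `q`-series
`θ_i`, `E` on `ℍ` (as `HasSum` in `q = e(τ)`), `r_i(0) = 1`, the limits `θ_i → 1` as `Im τ → ∞`,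
`e(0) ≠ 0`, `w ≠ 0`, the coefficient identity `w·e(n) = c₁·Σ_i r_i(n)` for `n ≥ 1`, the laws under
`γ₀ = (1 0; D 1)` (`D ≥ 1`) with factor `Dτ+1` (times units `Λ⁰_i` for the `θ_i`, exactly for `E`),
and under `γ` with factors `Λ_i (cτ+d)`, `χ (cτ+d)`, `|Λ_i| = |χ| = 1`.  Conclusion: `Λ_i = χ`. -/
theorem units_eq_of_thetaSum_eisenstein {ι : Type} [Fintype ι] [Nonempty ι]
    {θ : ι → ℍ → ℂ} {r : ι → ℕ → ℂ}
    (hθ : ∀ i (τ : ℍ), HasSum (fun n : ℕ => r i n * cexp (2 * π * Complex.I * (τ : ℂ)) ^ n) (θ i τ))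
    (hr0 : ∀ i, r i 0 = 1)
    (hlim : ∀ i, ∀ ε > 0, ∃ Y : ℝ, ∀ τ : ℍ, Y ≤ τ.im → ‖θ i τ - 1‖ < ε)
    {E : ℍ → ℂ} {e : ℕ → ℂ}
    (hE : ∀ τ : ℍ, HasSum (fun n : ℕ => e n * cexp (2 * π * Complex.I * (τ : ℂ)) ^ n) (E τ)) (he0 : e 0 ≠ 0)
    {w c₁ : ℂ} (hw : w ≠ 0) (hcoef : ∀ n : ℕ, n ≠ 0 → w * e n = c₁ * ∑ i, r i n)
    {γ₀ : SL(2, ℤ)} {D : ℕ} (hD : 0 < D) (hγ₀a : (γ₀ 0 0 : ℤ) = 1) (hγ₀b : (γ₀ 0 1 : ℤ) = 0)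
    (hγ₀c : (γ₀ 1 0 : ℤ) = D) (hγ₀d : (γ₀ 1 1 : ℤ) = 1)
    {Λ₀ : ι → ℂ} (hθ₀ : ∀ i (τ : ℍ), θ i (γ₀ • τ) = Λ₀ i * ((D : ℂ) * τ + 1) * θ i τ)
    (hE₀ : ∀ τ : ℍ, E (γ₀ • τ) = ((D : ℂ) * τ + 1) * E τ)
    {γ : SL(2, ℤ)} {Λ : ι → ℂ} {χ : ℂ} (hΛ1 : ∀ i, ‖Λ i‖ = 1) (hχ1 : ‖χ‖ = 1)
    (hθγ : ∀ i (τ : ℍ), θ i (γ • τ) = Λ i * (((γ 1 0 : ℤ) : ℂ) * τ + ((γ 1 1 : ℤ) : ℂ)) * θ i τ)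
    (hEγ : ∀ τ : ℍ, E (γ • τ) = χ * (((γ 1 0 : ℤ) : ℂ) * τ + ((γ 1 1 : ℤ) : ℂ)) * E τ) :
    ∀ i, Λ i = χ := by
  classical
  have _ := hγ₀a; have _ := hγ₀b; have _ := hγ₀c; have _ := hγ₀d
  set h : ℕ := Fintype.card ι with hh
  set K₀ : ℂ := w * e 0 - c₁ * h with hK₀
  -- Step 1: `w E - c₁ Σ θ_i ≡ K₀`
  have hF : ∀ τ : ℍ, w * E τ - c₁ * ∑ i, θ i τ = K₀ := by
    intro τ
    set q : ℂ := cexp (2 * π * Complex.I * (τ : ℂ)) with hq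
    have h1 : HasSum (fun n : ℕ => (w * e n - c₁ * ∑ i, r i n) * q ^ n) (w * E τ - c₁ * ∑ i, θ i τ) := by
      have hEw := (hE τ).mul_left w
      have hΘ : HasSum (fun n : ℕ => (∑ i, r i n) * q ^ n) (∑ i, θ i τ) := by
        have := hasSum_sum (f := fun i (n : ℕ) => r i n * q ^ n) (a := fun i => θ i τ)
          (s := Finset.univ) (fun i _ => hθ i τ)
        refine this.congr_fun fun n => ?_
        rw [Finset.sum_mul]
      have h := hEw.sub (hΘ.mul_left c₁)
      refine h.congr_fun fun n => ?_
      ring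
    have h2 : (fun n : ℕ => (w * e n - c₁ * ∑ i, r i n) * q ^ n) = fun n => if n = 0 then K₀ else 0 := by
      funext n
      by_cases hn : n = 0
      · subst hn
        simp [hK₀, hr0, hh]
      · rw [if_neg hn, hcoef n hn, sub_self, zero_mul]
    rw [h2] at h1
    have h3 : HasSum (fun n : ℕ => if n = 0 then K₀ else 0) K₀ := hasSum_ite_eq 0 K₀
    exact h1.unique h3
  -- `1`-periodicity of the `θ_i`
  have hper : ∀ i (τ : ℍ), θ i ((1 : ℝ) +ᵥ τ) = θ i τ := by
    intro i τ
    have h1 := hθ i ((1 : ℝ) +ᵥ τ)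
    rw [cexp_two_pi_I_vadd] at h1
    exact h1.unique (hθ i τ)
  -- Step 2: `K₀ = 0`
  have hD0 : (D : ℂ) ≠ 0 := by exact_mod_cast hD.ne'
  have hK₀0 : K₀ = 0 := by
    -- `G(τ) = Σ (1 - Λ⁰_i) θ_i(τ)` satisfies `K₀ = (Dτ+1)(K₀ + c₁ G(τ))` and is `1`-periodic
    have key : ∀ τ : ℍ, K₀ = ((D : ℂ) * τ + 1) * (K₀ + c₁ * ∑ i, (1 - Λ₀ i) * θ i τ) := by
      intro τ
      have h1 := hF (γ₀ • τ)
      rw [hE₀ τ] at h1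
      simp only [hθ₀] at h1
      have h2 := hF τ
      have e3 : ∑ i, Λ₀ i * ((D : ℂ) * τ + 1) * θ i τ = ((D : ℂ) * τ + 1) * ∑ i, Λ₀ i * θ i τ := by
        rw [Finset.mul_sum]; exact Finset.sum_congr rfl fun i _ => by ring
      have e4 : ∑ i, (1 - Λ₀ i) * θ i τ = ∑ i, θ i τ - ∑ i, Λ₀ i * θ i τ := by
        rw [← Finset.sum_sub_distrib]; exact Finset.sum_congr rfl fun i _ => by ring
      rw [e4]
      linear_combination -h1 + ((D : ℂ) * τ + 1) * h2 - c₁ * e3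
    obtain ⟨τ⟩ := (inferInstance : Nonempty ℍ)
    have k1 := key τ
    have k2 := key ((1 : ℝ) +ᵥ τ)
    simp only [hper] at k2
    rw [UpperHalfPlane.coe_vadd, Complex.ofReal_one] at k2
    -- subtract: `D · (K₀ + c₁ G τ) = 0`
    set G := K₀ + c₁ * ∑ i, (1 - Λ₀ i) * θ i τ with hG
    have hGz : G = 0 := by
      have : (D : ℂ) * G = 0 := by linear_combination k1 - k2
      exact (mul_eq_zero.mp this).resolve_left hD0
    rw [hGz, mul_zero] at k1
    exact k1
  -- hence `c₁ ≠ 0`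
  have hc₁ : c₁ ≠ 0 := by
    intro hc
    have : w * e 0 = 0 := by
      have := hK₀0; rw [hK₀, hc, zero_mul, sub_zero] at this; exact this
    exact (mul_ne_zero hw he0) this
  -- Step 3: `Σ (Λ_i - χ) θ_i ≡ 0`
  have hvan : ∀ τ : ℍ, ∑ i, (Λ i - χ) * θ i τ = 0 := by
    intro τ
    have h1 := hF (γ • τ)
    have h2 := hF τ
    rw [hK₀0] at h1 h2
    rw [hEγ τ] at h1
    simp only [hθγ] at h1
    have hden : (((γ 1 0 : ℤ) : ℂ) * τ + ((γ 1 1 : ℤ) : ℂ)) ≠ 0 := by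
      have := UpperHalfPlane.denom_ne_zero γ τ
      simpa [UpperHalfPlane.denom] using this
    have hwE : w * E τ = c₁ * ∑ i, θ i τ := by linear_combination h2
    have : c₁ * (((γ 1 0 : ℤ) : ℂ) * τ + ((γ 1 1 : ℤ) : ℂ)) * ∑ i, (Λ i - χ) * θ i τ = 0 := by
      have e1 : ∑ i, (Λ i - χ) * θ i τ = ∑ i, Λ i * θ i τ - χ * ∑ i, θ i τ := by
        rw [Finset.mul_sum, ← Finset.sum_sub_distrib]; exact Finset.sum_congr rfl fun i _ => by ring
      have e2 : ∑ i, Λ i * (((γ 1 0 : ℤ) : ℂ) * τ + ((γ 1 1 : ℤ) : ℂ)) * θ i τ =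
          (((γ 1 0 : ℤ) : ℂ) * τ + ((γ 1 1 : ℤ) : ℂ)) * ∑ i, Λ i * θ i τ := by
        rw [Finset.mul_sum]; exact Finset.sum_congr rfl fun i _ => by ring
      rw [e2] at h1
      rw [e1]
      linear_combination -h1 + χ * (((γ 1 0 : ℤ) : ℂ) * τ + ((γ 1 1 : ℤ) : ℂ)) * hwE
    exact (mul_eq_zero.mp this).resolve_left (mul_ne_zero hc₁ hden)
  -- Step 4: let `Im τ → ∞`: `Σ (Λ_i - χ) = 0`
  have hsum : ∑ i, (Λ i - χ) = 0 := by
    by_contra hne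
    set S : ℂ := ∑ i, (Λ i - χ) with hS
    have hSpos : 0 < ‖S‖ := norm_pos_iff.mpr hne
    -- choose `Y` with `‖θ_i τ - 1‖ < ‖S‖/(2 h + 1)·…` for all `i`
    set ε : ℝ := ‖S‖ / (2 * (∑ i : ι, ‖Λ i - χ‖) + 1) with hε
    have hεpos : 0 < ε := by
      rw [hε]; apply div_pos hSpos; positivity
    choose Y hY using fun i => hlim i ε hεpos
    set Ymax : ℝ := (Finset.univ.sup' Finset.univ_nonempty Y) ⊔ 1 with hYmax
    have hYpos : 0 < Ymax := lt_of_lt_of_le one_pos (le_sup_right)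
    set τ : ℍ := ⟨Complex.I * (Ymax : ℂ), by simpa using hYpos⟩ with hτ
    have hτim : τ.im = Ymax := by
      show (Complex.I * (Ymax : ℂ)).im = Ymax; simp
    have hclose : ∀ i, ‖θ i τ - 1‖ < ε := fun i => hY i τ (by
      rw [hτim, hYmax]
      exact le_trans (Finset.le_sup' Y (Finset.mem_univ i)) le_sup_left)
    have h0 := hvan τ
    -- `S = Σ (Λ_i - χ)(1 - θ_i τ)` in norm `≤ Σ ‖Λ_i - χ‖ ε < ‖S‖`
    have hS' : S = ∑ i, (Λ i - χ) * (1 - θ i τ) := by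
      have : ∑ i, (Λ i - χ) * (1 - θ i τ) = ∑ i, (Λ i - χ) - ∑ i, (Λ i - χ) * θ i τ := by
        rw [← Finset.sum_sub_distrib]; exact Finset.sum_congr rfl fun i _ => by ring
      rw [this, h0, sub_zero]
    have hle : ‖S‖ ≤ (∑ i, ‖Λ i - χ‖) * ε := by
      rw [hS']
      refine (norm_sum_le _ _).trans ?_
      rw [Finset.sum_mul]
      refine Finset.sum_le_sum fun i _ => ?_
      rw [norm_mul]
      refine mul_le_mul_of_nonneg_left ?_ (norm_nonneg _)
      rw [norm_sub_rev]; exact (hclose i).le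
    have hlt : (∑ i, ‖Λ i - χ‖) * ε < ‖S‖ := by
      rw [hε]
      have hA : 0 ≤ ∑ i : ι, ‖Λ i - χ‖ := Finset.sum_nonneg fun i _ => norm_nonneg _
      rw [mul_div_assoc']
      rw [div_lt_iff₀ (by positivity)]
      nlinarith
    linarith
  -- Step 5: unit vectors
  have hsum' : ∑ i, Λ i = Fintype.card ι * χ := by
    have : ∑ i, (Λ i - χ) = ∑ i, Λ i - Fintype.card ι * χ := by
      rw [Finset.sum_sub_distrib, Finset.sum_const, Finset.card_univ, nsmul_eq_mul]
    rw [this] at hsum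
    linear_combination hsum
  exact eq_of_sum_eq_card_mul hΛ1 hχ1 hsum'

end Summit.BirchSwinnertonDyer.BirchSwinnertonDyer.Theorems.HeckeTheta

end
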